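import Mathlib.AlgebraicGeometry.EllipticCurve.LFunction
import Literature.NumberTheory.Automorphic.BrandtXi
import Literature.NumberTheory.EllipticCurves.ModularCurve
import Literature.NumberTheory.DiophantineGeometry.MinimalDiscriminant
import Literature.NumberTheory.DiophantineGeometry.Conductor
import HarnessLib

/-!
# Takahashi's formula `δ = h_r · j_r / i_r` for the modular degree through the character group
# at `r ∥ N` (Takahashi 2001, Thm. 2.3), case `D = 1` of the modular curve `X₀(N)`

Topic `Literature/NumberTheory/EllipticCurves`; ONE named fact (`def … : Prop`, statement only,
D-0014) and its elementary corollaries. Grounds route `ABC/DefiniteXi`, items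
`Summit.ABC.ABC.Theses.DefiniteXi.DefiniteRTControl` (stmt-ABC-2022) and the glue
`XiStrongBound → FreyDegreeBound` (stmt-ABC-2023) in the case of a PRIME `N⁻ = r`: it is the
integral (all primes at once, no Eisenstein / CR hypothesis) comparison between the optimal modular
degree `δ_{1,N}` and the definite congruence number `ξ(E; N/r, r) = Σ_i w_i φ_i²` of the tree
(`Literature.NumberTheory.Automorphic.brandtXi`, `Brandt.XiSetup.xi`), complementing the `p`-by-`p`
statements `PollackWeston2011_thm_6_8` / `PollackWeston2011.thm_6_8_ellipticCurve` (which need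
`p ≥ 5`, `p ∤ N` and hypothesis CR).

## Source, as printed

S. Takahashi, *Degrees of parametrizations of elliptic curves by Shimura curves*, J. Number
Theory **90** (2001) 74–88 [Takahashi2001], read in full (`lit read doi:10.1006/jnth.2000.2614`,
pp. 76–85 of the journal):

* §2, p. 77–78 (setting): *"fix a square-free positive integer `N` and an isogeny class `𝓔` of
  semistable elliptic curves of conductor `N` defined over `ℚ`. Consider a pair `(D, M)` such that
  `N = DM` and the number of prime factors of `D` is even. Let `J = J₀^D(M)` … Consider an optimal
  quotient `π : J → E` and its dual `π^∨ : E → J`, where `E` is in `𝓔`. The composite `π ∘ π^∨`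
  is multiplication by an integer. The degree `δ = δ_D(M) ∈ ℤ` is defined as this integer. … For
  a prime `r ∣ N`, `π` induces the map `π_* : Φ_r(J) → Φ_r(E)` on groups of connected components
  of Néron fibers at `r`. Define integers `c_r = #Φ_r(E)`, `i_r = #image(π_*)`, `j_r = #coker(π_*)`.
  … `L_r(J) = {x ∈ X_r(J) : T_n x = a_n(f) x for all n prime to N}` … `L_r(J)` is a free
  `ℤ`-module of rank one. Let `g_r` be a generator of `L_r(J)` and define `h_r = u_J(g_r, g_r)`,
  where `u_J` is the monodromy pairing on `X_r(J)`"* (`X_r` = character group of the torus of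
  the Néron fibre at `r`, `u_J` Grothendieck's pairing, Prop. 1.1 = SGA 7 Thm. 11.5).
* p. 79: *"Since `j_r = c_r / i_r` …"* (proof of Lemma 2.2), and
  **Theorem 2.3.** *"`i_r` divides `h_r`, and `δ = (h_r / i_r) · j_r`. In particular, `j_r`
  divides `δ`."* — p. 80: *"The results stated so far are true for any prime `r` dividing `N`."*
* §3.2, p. 84, proof of Thm. 3.8 (the dictionary with the definite quaternion algebra): *"By
  Theorem 4.7 in [3] (= [Buzzard1997]), `X_r(J₀^{(d/r)}(rm))` is canonically isomorphic to the
  group of degree-0 divisors on the set of isomorphism classes of locally free rank-1 right modules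
  over the Eichler order of level `m` in the definite quaternion algebra of discriminant `d`. The
  isomorphism is compatible with the action of Hecke operators `T_n`, for `n` prime to `N` as well
  as with the monodromy pairings"* (here `d ∣ N` has an odd number of prime factors, `r ∣ d`,
  `N = dm`); for `d = r` prime this is the classical description of `X_r(J₀(N))`, `r ∥ N`, by
  supersingular points / the Brandt module of level `N/r` in the quaternion algebra ramified at
  `{r, ∞}` (Ribet 1990 [Ribet1990], Prop. 3.1–3.3; Kohel, = Pollack–Weston 2011 Prop. 6.5, where
  the monodromy pairing is `⟨e_i, e_j⟩ = w_i δ_ij`, `w_i = #O_iˣ/2`).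

## Rendering (case `D = 1`, `J = J₀(N)`, `N = M · r` squarefree, `r` prime)

(i) `δ = δ_1(N)` is the degree of the optimal parametrisation `X₀(N) → E`, `E` the `X₀(N)`-optimal
curve of the class. Over the tree (no Jacobians) this is expressed exactly as in
`PollackWeston2011.thm_6_8_ellipticCurve` (iii) / `modularDegree_dvd_congruenceNumber`: a datum
`P : ModularParametrizationData W N` whose degree is minimal among ALL data at level `N`, of all
elliptic `W'/ℚ`, with the same newform. Such a `W` is then ℚ-isomorphic to the optimal curve `E`
(every parametrisation factors through the optimal quotient; the datum's map `ℂ/Λ_f → ℂ/Λ_W`,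
`z ↦ c z` with `c ∈ ℤ`, is a ℚ-isogeny), so `P.modularDegree = δ` and `c_r = #Φ_r(E) = #Φ_r(W)`.
(ii) `c_r = ord_r Δ_min(W)`: `W` has multiplicative reduction at `r ∥ N`, and the group of
geometric components of a multiplicative fibre is cyclic of order `ord_r Δ_min` (Tate curve;
Pasten arXiv:1705.09251 p. 22: "`Φ_p(A)` is a cyclic group of order `c_p(A) := v_p(Δ_A)`");
`ord_r Δ_min(W) = (W.minimalDiscriminantNorm ℤ).factorization r` (tree file
`DiophantineGeometry/MinimalDiscriminant`).
(iii) `h_r = S.xi (a_n(W))_n` for EVERY Brandt setup `S : Brandt.XiSetup M r` of the tree (a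
definite quaternion algebra over `ℚ` ramified exactly at `r`, with an Eichler order `O` of level
`M = N/r`): by the displayed identification `X_r(J₀(N)) ≅ ℤ[Cls O]⁰` (Hecke- and
pairing-compatible; Eichler orders of the same level are locally conjugate, so every setup gives
isomorphic Brandt data, cf. `Brandt.xi_eigenLattice_reindex`), `L_r(J)` is the eigen-lattice
`Brandt.eigenLattice N (Brandt.matrix S.O) (a_n(W))` (a line, as printed: "free of rank one" —
the `a_p`-eigenvectors are orthogonal to the Eisenstein vector, hence of degree `0`), and
`u_J(g_r, g_r) = Σ_i w_i g_i² = Brandt.xi`, i.e. `S.xi`. The coefficients `a_n(W)` are those of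
Mathlib's `WeierstrassCurve.LFunction` (as in `BrandtModuleJLSelfPairing`,
`PollackWeston2011.thm_6_8_ellipticCurve`). Quantifying over all setups (rather than naming
`brandtXi`, the value on a chosen one) follows the design of `BrandtXi.lean`
(`brandtXi_le_of_forall` / `le_brandtXi_of_forall`); the `brandtXi` form is the corollary
`takahashi2001_thm_2_3.modularDegree_le_brandtXi_mul` below.
(iv) Printed standing hypotheses KEPT: `N` squarefree (the class is semistable). Takahashi notes
(p. 80) that Thm. 2.3 holds "for any prime `r` dividing `N`", and its proof (Grothendieck's exact
sequence at `r`, Lemma 2.1, adjointness of `π^*`, `π_*`) is local at `r`; Pasten 2024 Prop. 6.13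
records that the Ribet–Takahashi arguments do not need `M` squarefree. A user needing additive
primes away from `r` (e.g. Frey–Hellegouarch curves with `4 ∣ N`) must say so: that extension is
NOT asserted here.
(v) The conclusion is recorded with `i = i_r`, `j = j_r` existentially: `0 < i`, `i · j = c_r`,
`i ∣ h_r`, `δ · i = h_r · j` (the printed `δ = (h_r/i_r) j_r` cleared of the exact division).

NOT here: the case `D > 1` (Shimura curves `X₀^D(M)` and their degrees `δ_D(M)` are not in the
tree), Thm. 2.4 / Cor. 2.6 (`j_r = 1` for `r ∣ D`), Thm. 2.7, §3 (Thm. 3.2, the Bertolini–Darmon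
formula Cor. 3.5, Thm. 3.7–3.8 as invariance statements), Ribet–Takahashi 1997 Thm. 1 and Pasten
2024 Thm. 6.1 (`δ_{1,N}/δ_{D,M} = γ ∏_{p∣D} v_p(Δ_E)`, numerator of `γ` ≤ `163^{ω(D)}`), which
together with this fact give the general-`N⁻` comparison used by route `ABC/DefiniteXi`.

## References

* [Takahashi2001] S. Takahashi, Degrees of parametrizations of elliptic curves by Shimura curves,
  J. Number Theory 90 (2001) 74–88, doi:10.1006/jnth.2000.2614 — §2 pp. 77–80 (Lemma 2.1, 2.2,
  Thm. 2.3), §3.2 p. 84 (proof of Thm. 3.8). READ.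
* [Buzzard1997] K. Buzzard, Integral models of certain Shimura curves, Duke Math. J. 87 (1997),
  Thm. 4.7 (cited through Takahashi).
* [Ribet1990] K. Ribet, On modular representations of Gal(ℚ̄/ℚ) arising from modular forms,
  Invent. Math. 100 (1990), §3 (character group of `J₀(N)` at `r ∥ N` and supersingular points).
* [PollackWeston2011] R. Pollack, T. Weston, Compositio Math. 147 (2011), §2.1, Prop. 6.5 (Kohel).
* [RibetTakahashi1997] K. Ribet, S. Takahashi, PNAS 94 (1997) 11110–11114, Thm. 1–2; proof of Thm. 2
  and Prop. 2 (body setting without square-free hypothesis; read in the cell on the PMC text).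
* [PastenShimura2024] H. Pasten, Shimura curves and the abc conjecture, arXiv:1705.09251 = JNT 254
  (2024), p. 22 (`c_p = v_p(Δ)`), Thm. 6.1 p. 20, Prop. 6.13 p. 23. READ.
* [ConradStein2001] B. Conrad, W. A. Stein, Component groups of purely toric quotients, Math. Res.
  Lett. 8 (2001) 745–766, §2.1, Thm. 6.1, Prop. 6.5, Cor. 6.6, §7.1, §7.4. READ
  (doi:10.4310/mrl.2001.v8.n6.a5).
* [Kohel2001] D. Kohel, Hecke module structure of quaternions, Adv. Stud. Pure Math. 30 (2001)
  177–195, §3.1–3.2, Thm. 4.2–4.3. READ (doi:10.2969/aspm/03010177).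
-/

noncomputable section

open scoped BigOperators

namespace Literature.NumberTheory.EllipticCurves

open Literature.NumberTheory.Automorphic Literature.NumberTheory.EllipticCurves.ModularForms

/-- **Takahashi 2001, Theorem 2.3 (case `D = 1`): `δ = h_r · j_r / i_r`, `i_r ∣ h_r`,
`i_r j_r = c_r`** — NAMED FACT, statement only. Printed (J. Number Theory 90, p. 79): *"Theorem
2.3. `i_r` divides `h_r`, and `δ = (h_r/i_r) · j_r`. In particular, `j_r` divides `δ`"*, with
(p. 78) `δ` the degree of the optimal quotient `J₀^D(M) → E`, `c_r = #Φ_r(E)`,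
`i_r = #image(Φ_r(J) → Φ_r(E))`, `j_r = #coker = c_r/i_r`, `h_r = u_J(g_r, g_r)` the monodromy
self-pairing of a generator of the `a(f)`-eigenline `L_r(J)` of the character group `X_r(J)`,
under the standing hypothesis "`N` square-free" (semistable class), for any prime `r ∣ N`.
Rendered for `D = 1`, `J = J₀(N)`, `N = M r` (module docstring (i)–(v)): `W/ℚ` elliptic of
squarefree conductor `M r`, `r` prime; `P` a parametrisation datum of `W` at level `M r` of
minimal degree among all data of all elliptic `W'` with the same newform (so `W` is the optimal
curve and `P.modularDegree = δ_1(N)`); `c_r = ord_r Δ_min(W)`; and for every Brandt setup `S` of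
type `(M, r)` (definite quaternion algebra of discriminant `r`, Eichler order of level `M`),
`h_r = S.xi (a_n(W))_n = Σ_i w_i g_i²` by `X_r(J₀(N)) ≅ ℤ[Cls O]⁰` (Takahashi p. 84 via Buzzard
Thm. 4.7; Ribet 1990 §3; Pollack–Weston Prop. 6.5). Conclusion: there are `i, j ∈ ℕ` with
`0 < i`, `i · j = ord_r Δ_min(W)`, `i ∣ S.xi (a(W))` and `P.modularDegree · i = S.xi (a(W)) · j`.
Grounds `Summit.ABC.ABC.Theses.DefiniteXi.DefiniteRTControl` / `.XiStrongBound` for prime `N⁻`.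
[cite: Takahashi2001, Thm. 2.3 (p. 79) with Lemma 2.1–2.2 and proof of Thm. 3.8 (p. 84)] [cite: Ribet1990, §3] [cite: PollackWeston2011, Prop. 6.5] -/
def takahashi2001_thm_2_3 : Prop :=
  ∀ (W : WeierstrassCurve ℚ) [W.IsElliptic] (M r : ℕ) [NeZero (M * r)],
    r.Prime → Squarefree (M * r) → W.conductorNorm ℤ = M * r →
    ∀ P : ModularParametrizationData W (M * r),
      (∀ (W' : WeierstrassCurve ℚ) [W'.IsElliptic] (P' : ModularParametrizationData W' (M * r)),
          P'.f = P.f → P.modularDegree ≤ P'.modularDegree) →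
      ∀ S : Brandt.XiSetup M r,
        ∃ i j : ℕ, 0 < i ∧ i * j = (W.minimalDiscriminantNorm ℤ).factorization r ∧
          i ∣ S.xi (fun n => W.LFunction n) ∧
          P.modularDegree * i = S.xi (fun n => W.LFunction n) * j

namespace takahashi2001_thm_2_3

/-- **Corollary: `δ_1(N) ≤ ξ_S(E; N/r, r) · ord_r Δ_min(E)` in every Brandt setup `S`** — from
`δ i = h_r j`, `i ≥ 1`, `i j = c_r` (Takahashi 2001 Thm. 2.3: the optimal modular degree is at
most the definite congruence number times the Tamagawa exponent at `r`; no Eisenstein hypothesis).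
PROVED from the named fact. [cite: Takahashi2001, Thm. 2.3] -/
theorem modularDegree_le_xi_mul (h : takahashi2001_thm_2_3) (W : WeierstrassCurve ℚ) [W.IsElliptic]
    (M r : ℕ) [NeZero (M * r)]
    (hr : r.Prime) (hsq : Squarefree (M * r)) (hN : W.conductorNorm ℤ = M * r)
    (P : ModularParametrizationData W (M * r))
    (hmin : ∀ (W' : WeierstrassCurve ℚ) [W'.IsElliptic] (P' : ModularParametrizationData W' (M * r)),
      P'.f = P.f → P.modularDegree ≤ P'.modularDegree)
    (S : Brandt.XiSetup M r) :
    P.modularDegree ≤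
      S.xi (fun n => W.LFunction n) * (W.minimalDiscriminantNorm ℤ).factorization r := by
  obtain ⟨i, j, hi, hij, -, hδ⟩ := h W M r hr hsq hN P hmin S
  calc P.modularDegree ≤ P.modularDegree * i := Nat.le_mul_of_pos_right _ hi
    _ = S.xi (fun n => W.LFunction n) * j := hδ
    _ ≤ S.xi (fun n => W.LFunction n) * (i * j) :=
        Nat.mul_le_mul_left _ (Nat.le_mul_of_pos_left _ hi)
    _ = _ := by rw [hij]

/-- **Corollary, `brandtXi` form: `δ_1(N) ≤ ξ(E; N/r, r) · ord_r Δ_min(E)`** with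
`ξ = brandtXi (N/r) r (a(E))` (the value on the chosen setup), provided a setup of type `(N/r, r)`
exists (tree: `Brandt.nonempty_xiSetup_of_nonempty_eichlerPackage` from the fact
`nonempty_eichlerPackage`). This is `Summit.ABC.ABC.Theses.DefiniteXi.DefiniteRTControl` for a prime
`N⁻ = r` at the optimal curve, with constant `1` in place of `C_ε N^ε`. PROVED from the named fact.
[cite: Takahashi2001, Thm. 2.3] -/
theorem modularDegree_le_brandtXi_mul (h : takahashi2001_thm_2_3) (W : WeierstrassCurve ℚ)
    [W.IsElliptic] (M r : ℕ) [NeZero (M * r)] (hr : r.Prime) (hsq : Squarefree (M * r)) (hN : W.conductorNorm ℤ = M * r)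
    (P : ModularParametrizationData W (M * r))
    (hmin : ∀ (W' : WeierstrassCurve ℚ) [W'.IsElliptic] (P' : ModularParametrizationData W' (M * r)),
      P'.f = P.f → P.modularDegree ≤ P'.modularDegree)
    (hS : Nonempty (Brandt.XiSetup M r)) :
    P.modularDegree ≤
      brandtXi M r (fun n => W.LFunction n) * (W.minimalDiscriminantNorm ℤ).factorization r := by
  obtain ⟨S, hS'⟩ := exists_brandtXi_eq hS (fun n => W.LFunction n)
  rw [hS']
  exact h.modularDegree_le_xi_mul W M r hr hsq hN P hmin S

/-- **Corollary: the eigen-line is honest** — in the situation of the fact, `ξ_S ≠ 0` in every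
setup (so the `a(E)`-eigen-lattice of the Brandt matrices is a line and `S.xi = Σ w_i g_i²`, not
the junk value; Takahashi p. 78: "`L_r(J)` is a free `ℤ`-module of rank one"), because
`δ ≥ 1` (`P.deg_pos`) and `c_r ≥ 1` force `j ≥ 1`. PROVED from the named fact.
[cite: Takahashi2001, §2 p. 78 and Thm. 2.3] -/
theorem xi_ne_zero (h : takahashi2001_thm_2_3) (W : WeierstrassCurve ℚ) [W.IsElliptic] (M r : ℕ)
    [NeZero (M * r)]
    (hr : r.Prime) (hsq : Squarefree (M * r)) (hN : W.conductorNorm ℤ = M * r)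
    (P : ModularParametrizationData W (M * r))
    (hmin : ∀ (W' : WeierstrassCurve ℚ) [W'.IsElliptic] (P' : ModularParametrizationData W' (M * r)),
      P'.f = P.f → P.modularDegree ≤ P'.modularDegree)
    (S : Brandt.XiSetup M r) : S.xi (fun n => W.LFunction n) ≠ 0 := by
  obtain ⟨i, j, hi, -, -, hδ⟩ := h W M r hr hsq hN P hmin S
  intro h0
  rw [h0, zero_mul] at hδ
  have hpos : 0 < P.modularDegree * i := Nat.mul_pos P.deg_pos hi
  omega

end takahashi2001_thm_2_3

/-! ### The same at a prime dividing the conductor exactly (no square-free hypothesis) -/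

/-- **Takahashi 2001, Theorem 2.3 (case `D = 1`) at a prime of multiplicative reduction:
`δ = h_r · j_r / i_r`, `i_r ∣ h_r`, `i_r j_r = c_r`** — NAMED FACT, statement only; the tree's
`Literature.NumberTheory.EllipticCurves.takahashi2001_thm_2_3` with Takahashi's standing
hypothesis "`N` square-free" (J. Number Theory 90, p. 77) replaced by what the printed proof uses:
`r ∥ N`, i.e. `N = M r` with `gcd(M, r) = 1`.  Printed (p. 79): *"Theorem 2.3. `i_r` divides
`h_r`, and `δ = (h_r/i_r) · j_r`"*, with `δ` the degree of the optimal quotient `J₀(N) → E`,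
`c_r = #Φ_r(E)`, `i_r = #image(Φ_r(J₀(N)) → Φ_r(E))`, `j_r = c_r/i_r`, `h_r = u_J(g_r, g_r)` the
monodromy self-pairing of a generator of the `a(f)`-eigenline `L_r(J)` of the character group
`X_r(J₀(N))`; p. 80: *"The results stated so far are true for any prime `r` dividing `N`."*  The
proof (Prop. 1.1 = SGA 7 IX 11.5, Lemma 2.1–2.2, adjointness of `π^*`, `π_*`, surjectivity of
`π_*` from optimality) uses only that `J₀(N)` has semistable reduction at `r` (Deligne–Rapoport,
`r ∥ N`) and that `E` is multiplicative at `r` (`X_r(E) ≅ ℤ`, `c_r = ord_r Δ_min`); Pasten 2024,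
Prop. 6.13: *"the proof in loc. cit. [Ribet–Takahashi 1997, Prop. 1, Thm. 2 — the same
computation] does not need `M` to be squarefree … one just needs multiplicative reduction at the
two primes"*.  The dictionary `h_r = ξ_S(a(E)) = Σ_i w_i g_i²` in every Brandt setup `S` of
type `(M, r)` is Takahashi p. 84 (Buzzard Thm. 4.7) = Ribet 1990 §3 (the character group of
`J₀(rM)` at `r ∤ M`, `M ≥ 1` arbitrary, is `ℤ[Cls O]⁰` for an Eichler order `O` of level `M` in
the definite quaternion algebra of discriminant `r`, Hecke- and pairing-compatibly), exactly as
rendered in the tree's fact (module docstring (iii) of `TakahashiDegreeFormula.lean`, with the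
setup-independence `Brandt.XiSetup.xi_eq_xi` proved in the tree).  Rendering: `W/ℚ` elliptic of
conductor `M r`, `r` prime, `gcd(M, r) = 1`; `P` a datum of `W` at level `M r` of minimal degree
among the data, at level `M r`, of all elliptic `W'` of conductor `M r` with the same newform
(all curves with that newform have conductor `M r`, Carayol; so `W` is the optimal curve and
`P.modularDegree = δ_1(N)`); conclusion as in the tree's fact: `∃ i j`, `0 < i`,
`i j = ord_r Δ_min(W)`, `i ∣ S.xi (a(W))`, `P.modularDegree · i = S.xi (a(W)) · j`.  Needed beyond
the square-free case by `Summit.ABC.ABC.Theses.DefiniteXi.DefiniteRTControlPrime` (Frey curves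
with `4 ∣ N`). It implies the tree's fact (`takahashi2001_thm_2_3_of_of_coprime`).
PRINTED SOURCES AT ARBITRARY COFACTOR `M` (refereed print by composition, read first-hand in the cell
`pub/bsd-litref/bstw24` — reader sheets r2 TWIST-ADD-7, 8, 9 and r1 MOAKHER319-ADD-3, 4; ARM-P
`pub/bsd-cited/sheets/AUDIT-Takahashi01Thm23-S6-r16` "VERBATIM-COMPOSITE"; referee C4 ROUNDS
C4-R3-ADD-12 (α) "(F1) UPGRADED to PUB-BY-COMPOSITION", C4-R3-ADD-13, C4-R3-ADD-14 (c)(d)):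
(comp-1) Conrad–Stein, Math. Res. Lett. 8 (2001), Thm. 6.1 with Prop. 6.5 and Cor. 6.6
(`#Φ_A/#Φ_X = m_A/m_X`, `#coker(Φ_J → Φ_A) = m_A/m_L` for an optimal purely toric quotient `A` of a
semistable `J` with symmetric principal polarization; pp. 747, 751, 753–754) in the setting of their
§7.1/§7.4 (`J = J₀(N)`, `N = M p`, `p ∥ N`, `M` ARBITRARY: "the `p`-new part of `J₀(N)` has purely
toric reduction at `p` when `p ∥ N`", pp. 754–755) — at `A = E`: `m_E = δ`, `Φ_X = ℤ/i_r`,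
`m_X = h_r/i_r`, whence `δ · i_r = h_r · j_r`, `i_r j_r = c_r` — composed with Kohel, Adv. Stud. Pure
Math. 30 (2001), Thm. 4.3 at `D = 1` (`X(p, m) ≅ 𝒳(J₀(mp), p)` canonically, compatibly with `T_n`
for `(n, pm) = 1`, and isometrically; `m` arbitrary; inner product `½|Isom(I, J)|` = `Brandt.weight`
on the diagonal): every instance. (comp-2) Ribet–Takahashi, PNAS 94 (1997), PROOF of Thm. 2 with
Prop. 2 (the identity `δ · c_q = j_q² · h_q` printed on `J₀^D(pqM)` itself, `D = 1` allowed; the body's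
setting `N = DM`, `(D, M) = 1` carries no square-free hypothesis before the "from now on" placed after
Prop. 2) with Pasten 2024 Prop. 6.13 (the refereed licence-remark quoted above): needs a second
multiplicative prime, idle in the proof. Ribet 1990 §3 is the `D = 1` attribution behind Kohel's
Thm. 4.2 / Ribet–Takahashi's Prop. 1, not load-bearing by name. No kernel discharge is in reach
(Néron models and character groups are not in the tree). Consumer at a prime `N⁻`:
`RibetTakahashiDefinitePrime.lean` (`ord_p r_f = ord_p ξ_S` when `p ∤ c_q`).
[cite: Takahashi2001, Thm. 2.3 (p. 79), remark p. 80, proof of Thm. 3.8 (p. 84)]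
[cite: PastenShimura2024, Prop. 6.13 (p. 23)] [cite: Ribet1990, §3]
[cite: ConradStein2001, Thm. 6.1, Prop. 6.5, Cor. 6.6, §7.1, §7.4]
[cite: Kohel2001, Thm. 4.3 (D = 1), §3.1–3.2] [cite: RibetTakahashi1997, proof of Thm. 2 and Prop. 2] -/
def takahashi2001_thm_2_3_of_coprime : Prop :=
  ∀ (W : WeierstrassCurve ℚ) [W.IsElliptic] (M r : ℕ) [NeZero (M * r)],
    r.Prime → M.Coprime r → W.conductorNorm ℤ = M * r →
    ∀ P : ModularParametrizationData W (M * r),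
      (∀ (W' : WeierstrassCurve ℚ) [W'.IsElliptic], W'.conductorNorm ℤ = M * r →
          ∀ P' : ModularParametrizationData W' (M * r),
          P'.f = P.f → P.modularDegree ≤ P'.modularDegree) →
      ∀ S : Brandt.XiSetup M r,
        ∃ i j : ℕ, 0 < i ∧ i * j = (W.minimalDiscriminantNorm ℤ).factorization r ∧
          i ∣ S.xi (fun n => W.LFunction n) ∧
          P.modularDegree * i = S.xi (fun n => W.LFunction n) * j

/-- The prime-exactly-dividing form implies the tree's square-free form of Takahashi's Thm. 2.3:
a square-free `M r` has `gcd(M, r) = 1`, and minimality among all data with the same newform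
implies minimality among those of conductor `M r`. [cite: Takahashi2001, Thm. 2.3 (p. 79)] -/
theorem takahashi2001_thm_2_3_of_of_coprime (h : takahashi2001_thm_2_3_of_coprime) :
    takahashi2001_thm_2_3 := by
  intro W _ M r _ hr hsq hN P hmin S
  exact h W M r hr (Nat.coprime_of_squarefree_mul hsq) hN P
    (fun W' _ _ P' hP' => hmin W' P' hP') S

end Literature.NumberTheory.EllipticCurves

end
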